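import Literature.Probability.RandomPlanarGeometry.HexSAWStripWidthTwoContactAsymptotics
import HarnessLib

/-!
# The width-two strip at criticality: the VARIANCE of the number of surface contacts of a long bridge is LINEAR in the length,
# with the explicit universal rate `σ̂₂ = (96 − 67√2)/4` per hat index (`σ₂² = (96 − 67√2)/8 = 0.15596…` per step)
# (module «WIDTH-TWO CONTACT VARIANCE RATE»)

Topic `Literature/Probability/RandomPlanarGeometry` (continues «WIDTH-TWO CONTACT ASYMPTOTICS» — `W2.slopeCTwo`, `W2.interceptCTwo`, `W2.devGSumTwo`,
`W2.devDSumTwo`, `W2.rhoTwo`, `W2.exists_gTwo_pow_mul_sub_abs_le`, `W2.hatCD_two_succ_apply_eq` —, «WIDTH-TWO CONTACT RECURSION» — `W2.hatC2D`,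
`W2.hatC2D_two_succ`, `W2.kOneTwo` —, «WIDTH-TWO HAT CONVERGENCE» — `W2.projTwo`, `W2.limTwo`, `W2.nilTwo`, `W2.pTwo`, `W2.kTwo`, `W2.nilTwo_cubic`,
`W2.hatD_two_eq_pow_mul` — and the lane tool «CONVOLUTION ASYMPTOTICS» — `Literature.Analysis.abs_cauchyProdCoeff_sub_le`, `abs_cauchyProdCoeff_sub_le_two`).
Lane «pcv-sawmu» (CriticalPhenomena venture), a-p2 g27 — CAR V-C part 2b of `HOME/pub-sawmu-a-p2/g26/DESIGN-VARIANCE-RATE-T2.md` §5 (steps (3′)–(6)).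
Setting: W. Feller I (1968) XIII.6 (the number `N_k` of renewals has `E N_k = k/μ + O(1)` and `Var N_k = (σ²/μ³)·k + O(1)` — the renewal argument
for the first two moments); R. P. Stanley, EC1 (2012) §4.1 Theorem 4.1.1 (iii) (a pole of order `m` contributes a polynomial of degree `m − 1`).  The strip
is a four-type matrix renewal, the constants below are its explicit instance at `T = 2`; nothing below is printed.

## What is proved (namespace `…SAW.HV.W2`; `y = y₂ = stripYT 2`, `x = x_c`, `Π = projTwo`, `N = nilTwo`, `A = limTwo`, `P = 1 + M̂(0)`)

§1 Two analytic tools (plumbing, stated on sequences): `tendsto_cauchyProdCoeff_sub_quadratic` (the `Tendsto` form of the second-order lemma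
`abs_cauchyProdCoeff_sub_le_two`) and `tendsto_ratio_var_sub_linear` (the variance algebra: if `(k+1)²(D_k − A) → 0`, `(k+1)(C_k − μ₁(k+1) − μ₀) → 0`,
`Q_k − (q(k+1)² + ℓ(k+1) + m) → 0`, `A ≠ 0` and `qA = μ₁²`, then `Q_k/D_k − (C_k/D_k)² − ((ℓA − 2μ₁μ₀)/A²)(k+1) → (mA − μ₀²)/A²`).
§2 The constants: `phiTwo a = x y Π_{a2} + x² y Π_{a3}`, `psiTwo a = x y devGSumTwo a 2 + x² y devGSumTwo a 3` (so `slopeCTwo a b = A_{3b}·phiTwo a`,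
`interceptCTwo a b = A_{3b}·psiTwo a + phiTwo a·devDSumTwo b`), the first-moment deviation series `devGMomTwo a c = Σ' i·((G^i)_{ac} − Π_{ac})`, `chiTwo`,
the second-order data `aOneTwo b = 2·slopeCTwo 3 b`, `aZeroTwo b = A_{3b} + 2·interceptCTwo 3 b − 2·slopeCTwo 3 b`, `devQSumTwo b`, and the three
coefficients `quadQTwo`, `linQTwo`, `constQTwo` of the squared-contact sums.
§3 Quantitative first order: ★ `exists_hatCD_two_sub_linear_abs_le` — `|Ĉ_D(k+1)_{ab} − (slope·(k+1) + intercept)| ≤ C·(k+1)·ρᵏ` (explicit-rate form of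
«WIDTH-TWO CONTACT ASYMPTOTICS»).
§4 Second order: ★ `hatC2D_two_eq_sum` — `Ĉ²_D(k+1) = Σ_{j≤k} G^{k−j}·K₁·(G^jP + 2Ĉ_D(j))` (every `y > 0`); `hatC2D_two_succ_apply_eq` (two Cauchy
products); `exists_aSeqTwo_abs_le`; ★★ `tendsto_hatC2D_two_sub_quadratic` — `Ĉ²_D(k+1)_{ab} − (quadQTwo a b (k+1)(k+2) + linQTwo a b (k+1)) → constQTwo a b`.
§5 The exact constants: ★ `limTwo_three_mul_phiTwo` (the rank-one identity `φ₃·A_{ab} = A_{3b}·φ_a` — what makes the quadratic terms of the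
variance cancel), `quadQTwo_mul_limTwo` (`q·A = μ₁²`), ★ `varRate_identity` (`(q + ℓ)A − 2μ₁μ₀ = φ₃·(1 − φ₃ + 2ψ₃)·A²` for ALL `a, b`),
`phiTwo_three_eq` (`φ₃ = ½ + x² = (3 − √2)/2 = 2θ₂`), `devGSumTwo_mul_eq` (closed form of the deviation series:
`Σ'_i (G^i − Π) = (1 − Π) + ((1+p)N + N²)/(1+p+κ)` entrywise, from `N³ + pN² + κN = 0`), ★ `psiTwo_three_eq` (`ψ₃ = −9/4 + 8x² = 23/4 − 4√2`),
★ `varRateHat_eq` (`φ₃·(1 − φ₃ + 2ψ₃) = (96 − 67√2)/4`), `limTwo_pos`.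
§6 ★★★ **`tendsto_varTopTwo_sub_linear (a b)`**: with `meanTopTwo k a b = Ĉ_D(k)_{ab}/D̂(k)_{ab}` (the mean number of surface contacts of a bridge
`a → b` of hat index `k` under the critical weights) and `varTopTwo k a b = Ĉ²_D(k)_{ab}/D̂(k)_{ab} − meanTopTwo²` (its variance),
`varTopTwo (k+1) a b − ((96 − 67√2)/4)·(k+1) → varInterceptTwo a b` — THE VARIANCE OF THE CONTACT COUNT IS LINEAR IN THE LENGTH WITH A UNIVERSAL
(level-independent) EXPLICIT SLOPE and a convergent intercept; ★ `tendsto_meanTopTwo_sub_linear` (`meanTopTwo (k+1) a b − ((3 − √2)/2)(k+1) →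
interceptCTwo a b/limTwo a b`: the mean to order one, slope `2θ₂` per hat index); corollaries `tendsto_varTopTwo_succ_sub` (increments → `(96 − 67√2)/4`),
`tendsto_varTopTwo_div` (`varTopTwo k a b/k → (96 − 67√2)/4`), ★ `tendsto_varTopTwo_div_hatLen` (`varTopTwo k a b/(number of steps) → σ₂² = (96 − 67√2)/8`).

Numerics (kit `HOME/pub-sawmu-a-p2/g27/var/`: exact arithmetic in `ℚ(x_c)`, float DP of the recursions): `(96 − 67√2)/4 = 0.3119228303`,
`varInterceptTwo 0 0 = −0.940258945`, `varInterceptTwo 2 2 = −0.482629154`; `psiTwo 3 = 0.0931457505`.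
Label: LANE THEOREM (own result of lane «pcv-sawmu», a-p2 g27 with the g24/g26 design, 2026-08-28; the value `σ₂² = (96 − 67√2)/8` was MINED by a-p2 g24
from an exact DP and is PROVED here).  NOT claimed: a central limit theorem; the width-three analogue (the kernel `K₃` has infinite support).
-/

noncomputable section

open Finset Filter Topology Matrix Literature.Probability.LatticeModels Literature.Probability.Percolation Literature.Analysis

namespace Literature.Probability.RandomPlanarGeometry.SAW

namespace HV

namespace W2

/-! ## §1 Two analytic tools -/

/-- Second-order Tendsto form of «CONVOLUTION ASYMPTOTICS»: if `|a_k − (A₁(k+1) + A₀)| ≤ C_a (k+1) Rᵏ` and `|b_k − B| ≤ C_b Rᵏ` (`0 ≤ R < 1`), then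
`(a ∗ b)_k − ((A₁B/2)(k+1)(k+2) + (A₀B + A₁Σ'(b − B))(k+1)) → A₀Σ'(b − B) − A₁Σ' j(b_j − B) + BΣ'(a − A₁(·+1) − A₀)`
(the error bound of `abs_cauchyProdCoeff_sub_le_two` tends to `0`). [cite: Stanley2012EC1, §4.1 Theorem 4.1.1 (iii); lane «pcv-sawmu» a-p2 g27 — plumbing] -/
theorem tendsto_cauchyProdCoeff_sub_quadratic {a b : ℕ → ℝ} {A₁ A₀ B Ca Cb R : ℝ} (hR0 : 0 ≤ R) (hR1 : R < 1)
    (ha : ∀ k, |a k - (A₁ * ((k : ℝ) + 1) + A₀)| ≤ Ca * ((k : ℝ) + 1) * R ^ k) (hb : ∀ k, |b k - B| ≤ Cb * R ^ k) :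
    Tendsto (fun k : ℕ => cauchyProdCoeff a b k
        - (A₁ * B / 2 * ((k : ℝ) + 1) * ((k : ℝ) + 2) + (A₀ * B + A₁ * ∑' j, (b j - B)) * ((k : ℝ) + 1))) atTop
      (𝓝 (A₀ * ∑' j, (b j - B) - A₁ * ∑' j : ℕ, (j : ℝ) * (b j - B) + B * ∑' i : ℕ, (a i - A₁ * ((i : ℝ) + 1) - A₀))) := by
  set L : ℝ := A₀ * ∑' j, (b j - B) - A₁ * ∑' j : ℕ, (j : ℝ) * (b j - B) + B * ∑' i : ℕ, (a i - A₁ * ((i : ℝ) + 1) - A₀) with hL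
  set ε : ℕ → ℝ := fun k => |A₁| * Cb * ((k : ℝ) + 1) * R ^ (k + 1) / (1 - R) + |A₁| * Cb * ((k : ℝ) + 3) * R ^ (k + 1) / (1 - R) ^ 2
        + |A₀| * Cb * R ^ (k + 1) / (1 - R) + |B| * Ca * ((k : ℝ) + 3) * R ^ (k + 1) / (1 - R) ^ 2
        + Ca * Cb * ((k : ℝ) + 1) * ((k : ℝ) + 2) * R ^ k / 2 with hε
  have hbound : ∀ k, |cauchyProdCoeff a b k
      - (A₁ * B / 2 * ((k : ℝ) + 1) * ((k : ℝ) + 2) + (A₀ * B + A₁ * ∑' j, (b j - B)) * ((k : ℝ) + 1)) - L| ≤ ε k := fun k => by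
    have h := abs_cauchyProdCoeff_sub_le_two hR0 hR1 ha hb k
    have e : cauchyProdCoeff a b k - (A₁ * B / 2 * ((k : ℝ) + 1) * ((k : ℝ) + 2) + (A₀ * B + A₁ * ∑' j, (b j - B)) * ((k : ℝ) + 1)) - L
        = cauchyProdCoeff a b k - (A₁ * B / 2 * ((k : ℝ) + 1) * ((k : ℝ) + 2) + (A₀ * B + A₁ * ∑' j, (b j - B)) * ((k : ℝ) + 1)
          + (A₀ * ∑' j, (b j - B) - A₁ * ∑' j : ℕ, (j : ℝ) * (b j - B) + B * ∑' i : ℕ, (a i - A₁ * ((i : ℝ) + 1) - A₀))) := by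
      rw [hL]; ring
    rw [e]; exact h
  -- the error bound tends to zero: it is a combination of `k² Rᵏ`, `k Rᵏ`, `Rᵏ`
  have h0 : Tendsto (fun k : ℕ => R ^ k) atTop (𝓝 0) := tendsto_pow_atTop_nhds_zero_of_lt_one hR0 hR1
  have h1 : Tendsto (fun k : ℕ => (k : ℝ) * R ^ k) atTop (𝓝 0) := by
    simpa using tendsto_self_mul_const_pow_of_lt_one hR0 hR1
  have h2 : Tendsto (fun k : ℕ => (k : ℝ) ^ 2 * R ^ k) atTop (𝓝 0) := by
    simpa using tendsto_pow_const_mul_const_pow_of_lt_one 2 hR0 hR1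
  have hε0 : Tendsto ε atTop (𝓝 0) := by
    set α : ℝ := Ca * Cb / 2 with hα
    set β : ℝ := |A₁| * Cb * R / (1 - R) + |A₁| * Cb * R / (1 - R) ^ 2 + |B| * Ca * R / (1 - R) ^ 2 + 3 * (Ca * Cb / 2) with hβ
    set γ : ℝ := |A₁| * Cb * R / (1 - R) + 3 * (|A₁| * Cb * R / (1 - R) ^ 2) + |A₀| * Cb * R / (1 - R) + 3 * (|B| * Ca * R / (1 - R) ^ 2)
      + 2 * (Ca * Cb / 2) with hγ
    have e : ε = fun k : ℕ => α * ((k : ℝ) ^ 2 * R ^ k) + β * ((k : ℝ) * R ^ k) + γ * R ^ k := by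
      funext k
      simp only [hε, hα, hβ, hγ, pow_succ]
      ring
    rw [e]
    have := ((h2.const_mul α).add (h1.const_mul β)).add (h0.const_mul γ)
    simpa using this
  have hmain : Tendsto (fun k : ℕ => cauchyProdCoeff a b k
      - (A₁ * B / 2 * ((k : ℝ) + 1) * ((k : ℝ) + 2) + (A₀ * B + A₁ * ∑' j, (b j - B)) * ((k : ℝ) + 1)) - L) atTop (𝓝 0) :=
    squeeze_zero_norm (fun k => by rw [Real.norm_eq_abs]; exact hbound k) hε0
  have := hmain.add_const L
  simpa using this

/-- The variance algebra behind a LINEAR variance law (plumbing): if `(k+1)²(D_k − A) → 0`, `(k+1)(C_k − (μ₁(k+1) + μ₀)) → 0`,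
`Q_k − (q(k+1)² + ℓ(k+1) + m) → 0` with `A ≠ 0` and the cancellation `q·A = μ₁²`, then
`Q_k/D_k − (C_k/D_k)² − ((ℓA − 2μ₁μ₀)/A²)·(k+1) → (mA − μ₀²)/A²`.
[cite: Feller1968, XIII.6 (variance of the number of renewals); lane «pcv-sawmu» a-p2 g27 — plumbing] -/
theorem tendsto_ratio_var_sub_linear {D C Q : ℕ → ℝ} {A μ₁ μ₀ q ℓ m : ℝ} (hA : A ≠ 0) (hq : q * A = μ₁ ^ 2)
    (hD : Tendsto (fun k : ℕ => ((k : ℝ) + 1) ^ 2 * (D k - A)) atTop (𝓝 0))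
    (hC : Tendsto (fun k : ℕ => ((k : ℝ) + 1) * (C k - (μ₁ * ((k : ℝ) + 1) + μ₀))) atTop (𝓝 0))
    (hQ : Tendsto (fun k : ℕ => Q k - (q * ((k : ℝ) + 1) ^ 2 + ℓ * ((k : ℝ) + 1) + m)) atTop (𝓝 0)) :
    Tendsto (fun k : ℕ => Q k / D k - (C k / D k) ^ 2 - (ℓ * A - 2 * μ₁ * μ₀) / A ^ 2 * ((k : ℝ) + 1)) atTop
      (𝓝 ((m * A - μ₀ ^ 2) / A ^ 2)) := by
  set σ : ℝ := (ℓ * A - 2 * μ₁ * μ₀) / A ^ 2 with hσ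
  have hσA : σ * A ^ 2 = ℓ * A - 2 * μ₁ * μ₀ := by rw [hσ]; field_simp
  set εD : ℕ → ℝ := fun k => D k - A with hεD
  set εC : ℕ → ℝ := fun k => C k - (μ₁ * ((k : ℝ) + 1) + μ₀) with hεC
  set εQ : ℕ → ℝ := fun k => Q k - (q * ((k : ℝ) + 1) ^ 2 + ℓ * ((k : ℝ) + 1) + m) with hεQ
  -- `1/(k+1) → 0`
  have hinv : Tendsto (fun k : ℕ => ((k : ℝ) + 1)⁻¹) atTop (𝓝 0) := by
    have := (tendsto_one_div_add_atTop_nhds_zero_nat : Tendsto (fun n : ℕ => 1 / ((n : ℝ) + 1)) atTop (𝓝 0))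
    simpa using this
  -- lower-order smallness
  have hD1 : Tendsto (fun k : ℕ => ((k : ℝ) + 1) * εD k) atTop (𝓝 0) := by
    have := hD.mul hinv
    rw [mul_zero] at this
    refine this.congr fun k => ?_
    have hk : ((k : ℝ) + 1) ≠ 0 := by positivity
    simp only [hεD]
    field_simp
  have hD0 : Tendsto εD atTop (𝓝 0) := by
    have := hD1.mul hinv
    rw [mul_zero] at this
    refine this.congr fun k => ?_
    have hk : ((k : ℝ) + 1) ≠ 0 := by positivity
    simp only [hεD]
    field_simp
  have hC0 : Tendsto εC atTop (𝓝 0) := by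
    have := hC.mul hinv
    rw [mul_zero] at this
    refine this.congr fun k => ?_
    have hk : ((k : ℝ) + 1) ≠ 0 := by positivity
    simp only [hεC]
    field_simp
  have hDlim : Tendsto D atTop (𝓝 A) := by
    have := hD0.add_const A
    simpa [hεD] using this
  -- the numerator `Q D − C² − σ (k+1) D²` tends to `m A − μ₀²`
  set N : ℕ → ℝ := fun k => Q k * D k - C k ^ 2 - σ * ((k : ℝ) + 1) * D k ^ 2 with hN
  have hNeq : ∀ k : ℕ, N k = (m * A - μ₀ ^ 2) + (εQ k * A + q * (((k : ℝ) + 1) ^ 2 * εD k) + ℓ * (((k : ℝ) + 1) * εD k) + m * εD k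
      + εQ k * εD k - 2 * μ₁ * (((k : ℝ) + 1) * εC k) - 2 * μ₀ * εC k - εC k ^ 2 - 2 * σ * A * (((k : ℝ) + 1) * εD k)
      - σ * ((((k : ℝ) + 1) * εD k) * εD k)) := fun k => by
    simp only [hN, hεD, hεC, hεQ]
    linear_combination (((k : ℝ) + 1) ^ 2) * hq - ((k : ℝ) + 1) * hσA
  have hNlim : Tendsto N atTop (𝓝 (m * A - μ₀ ^ 2)) := by
    have hrest : Tendsto (fun k : ℕ => εQ k * A + q * (((k : ℝ) + 1) ^ 2 * εD k) + ℓ * (((k : ℝ) + 1) * εD k) + m * εD k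
        + εQ k * εD k - 2 * μ₁ * (((k : ℝ) + 1) * εC k) - 2 * μ₀ * εC k - εC k ^ 2 - 2 * σ * A * (((k : ℝ) + 1) * εD k)
        - σ * ((((k : ℝ) + 1) * εD k) * εD k)) atTop (𝓝 0) := by
      have t := ((((((((((hQ.mul_const A).add (hD.const_mul q)).add (hD1.const_mul ℓ)).add (hD0.const_mul m)).add (hQ.mul hD0)).sub
        (hC.const_mul (2 * μ₁))).sub (hC0.const_mul (2 * μ₀))).sub (hC0.pow 2)).sub (hD1.const_mul (2 * σ * A))).sub
        ((hD1.mul hD0).const_mul σ))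
      simpa using t
    have := hrest.const_add (m * A - μ₀ ^ 2)
    rw [add_zero] at this
    exact this.congr fun k => (hNeq k).symm
  -- the denominator
  have hD2 : Tendsto (fun k : ℕ => D k ^ 2) atTop (𝓝 (A ^ 2)) := hDlim.pow 2
  have hDne : ∀ᶠ k : ℕ in atTop, D k ≠ 0 := hDlim.eventually_ne hA
  have hquot := hNlim.div hD2 (pow_ne_zero 2 hA)
  refine hquot.congr' ?_
  filter_upwards [hDne] with k hk
  simp only [hN, Pi.div_apply]
  field_simp

/-! ## §2 The constants -/

/-- `φ_a = x·y₂·Π_{a2} + x²·y₂·Π_{a3}` (the contact row functional; `φ₃ = 2θ₂`). [cite: Feller1968, XIII.6; lane «pcv-sawmu» a-p2 g27] -/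
def phiTwo (a : Fin (2 * 2)) : ℝ :=
  hexCriticalFugacity * stripYT 2 * projTwo a 2 + hexCriticalFugacity ^ 2 * stripYT 2 * projTwo a 3

/-- `ψ_a = x·y₂·devGSumTwo a 2 + x²·y₂·devGSumTwo a 3` (the same functional of the deviation series `Σ'(G^i − Π)`). [cite: Feller1968, XIII.6; lane «pcv-sawmu» a-p2 g27] -/
def psiTwo (a : Fin (2 * 2)) : ℝ :=
  hexCriticalFugacity * stripYT 2 * devGSumTwo a 2 + hexCriticalFugacity ^ 2 * stripYT 2 * devGSumTwo a 3

/-- The first-moment deviation series `Σ' i·((G^i)_{ac} − Π_{ac})` (absolutely convergent: the terms are `O(ρ^i)`). [cite: Stanley2012EC1, §4.1; lane «pcv-sawmu» a-p2 g27] -/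
def devGMomTwo (a c : Fin (2 * 2)) : ℝ := ∑' i : ℕ, (i : ℝ) * ((gTwo (stripYT 2) ^ i) a c - projTwo a c)

/-- `χ_a = x·y₂·devGMomTwo a 2 + x²·y₂·devGMomTwo a 3`. [cite: Feller1968, XIII.6; lane «pcv-sawmu» a-p2 g27] -/
def chiTwo (a : Fin (2 * 2)) : ℝ :=
  hexCriticalFugacity * stripYT 2 * devGMomTwo a 2 + hexCriticalFugacity ^ 2 * stripYT 2 * devGMomTwo a 3

/-- `slopeCTwo a b = A_{3b}·φ_a`. [cite: Feller1968, XIII.6; lane plumbing] -/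
theorem slopeCTwo_eq (a b : Fin (2 * 2)) : slopeCTwo a b = limTwo 3 b * phiTwo a := by
  rw [slopeCTwo, phiTwo]

/-- `interceptCTwo a b = A_{3b}·ψ_a + φ_a·devDSumTwo b`. [cite: Feller1968, XIII.6; lane plumbing] -/
theorem interceptCTwo_eq (a b : Fin (2 * 2)) : interceptCTwo a b = limTwo 3 b * psiTwo a + phiTwo a * devDSumTwo b := by
  rw [interceptCTwo, psiTwo, phiTwo]
  ring

/-- The linear coefficient of the sequence `j ↦ (G^jP)_{3b} + 2·Ĉ_D(j)_{3b}`: `A₁ = 2·slopeCTwo 3 b`. [cite: Feller1968, XIII.6; lane «pcv-sawmu» a-p2 g27] -/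
def aOneTwo (b : Fin (2 * 2)) : ℝ := 2 * slopeCTwo 3 b

/-- Its constant coefficient: `A₀ = A_{3b} + 2·interceptCTwo 3 b − 2·slopeCTwo 3 b`. [cite: Feller1968, XIII.6; lane «pcv-sawmu» a-p2 g27] -/
def aZeroTwo (b : Fin (2 * 2)) : ℝ := limTwo 3 b + 2 * interceptCTwo 3 b - 2 * slopeCTwo 3 b

/-- Its deviation series `Σ' j ((G^jP)_{3b} + 2Ĉ_D(j)_{3b} − A₁(j+1) − A₀)` (convergent: the terms are `O((j+1)ρ^j)`). [cite: Feller1968, XIII.6; lane «pcv-sawmu» a-p2 g27] -/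
def devQSumTwo (b : Fin (2 * 2)) : ℝ :=
  ∑' j : ℕ, ((gTwo (stripYT 2) ^ j * (1 + hatMZeroTwo)) 3 b + 2 * hatCD (stripYT 2) j 3 b - aOneTwo b * ((j : ℝ) + 1) - aZeroTwo b)

/-- The quadratic coefficient of `Ĉ²_D(k+1)_{ab}` (in the basis `(k+1)(k+2)`, `(k+1)`, `1`): `q_{ab} = A₁φ_a/2 = slopeCTwo 3 b·φ_a`. [cite: Feller1968, XIII.6; lane «pcv-sawmu» a-p2 g27] -/
def quadQTwo (a b : Fin (2 * 2)) : ℝ := aOneTwo b * phiTwo a / 2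

/-- The linear coefficient of `Ĉ²_D(k+1)_{ab}`: `ℓ_{ab} = A₀φ_a + A₁ψ_a`. [cite: Feller1968, XIII.6; lane «pcv-sawmu» a-p2 g27] -/
def linQTwo (a b : Fin (2 * 2)) : ℝ := aZeroTwo b * phiTwo a + aOneTwo b * psiTwo a

/-- The constant coefficient of `Ĉ²_D(k+1)_{ab}`: `m_{ab} = A₀ψ_a − A₁χ_a + φ_a·devQSumTwo b`. [cite: Feller1968, XIII.6; lane «pcv-sawmu» a-p2 g27] -/
def constQTwo (a b : Fin (2 * 2)) : ℝ := aZeroTwo b * psiTwo a - aOneTwo b * chiTwo a + phiTwo a * devQSumTwo b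

/-! ## §3 Quantitative first-order asymptotics of the contact sums -/

/-- ★ **Explicit-rate linear asymptotics**: `∃ C, ∀ k, |Ĉ_D(k+1)_{ab} − (slopeCTwo a b·(k+1) + interceptCTwo a b)| ≤ C·(k+1)·ρᵏ` (`ρ = rhoTwo`) —
«CONVOLUTION ASYMPTOTICS» `abs_cauchyProdCoeff_sub_le` on the two Cauchy products of `hatCD_two_succ_apply_eq`.
[cite: Feller1968, XIII.6; Stanley2012EC1, §4.1 Theorem 4.1.1 (iii); lane «pcv-sawmu» a-p2 g27 — own] -/
theorem exists_hatCD_two_sub_linear_abs_le (a b : Fin (2 * 2)) :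
    ∃ C : ℝ, ∀ k : ℕ, |hatCD (stripYT 2) (k + 1) a b - (slopeCTwo a b * ((k : ℝ) + 1) + interceptCTwo a b)| ≤ C * ((k : ℝ) + 1) * rhoTwo ^ k := by
  obtain ⟨hr0, hrρ, hρ1, hρ0⟩ := rhoTwo_facts
  have hy : 0 < stripYT 2 := stripYT_pos (by norm_num)
  have hx : 0 < hexCriticalFugacity := hexCriticalFugacity_pos_lt_one.1
  obtain ⟨Ca, ha⟩ := exists_gTwo_pow_mul_sub_abs_le (1 + hatMZeroTwo) 3 b
  simp only [projTwo_mul_one_add] at ha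
  obtain ⟨C2, h2⟩ := exists_gTwo_pow_mul_sub_abs_le 1 a 2
  obtain ⟨C3, h3⟩ := exists_gTwo_pow_mul_sub_abs_le 1 a 3
  simp only [Matrix.mul_one] at h2 h3
  have hCa : 0 ≤ Ca := by have h := (abs_nonneg _).trans (ha 0); simpa using h
  have hC2 : 0 ≤ C2 := by have h := (abs_nonneg _).trans (h2 0); simpa using h
  have hC3 : 0 ≤ C3 := by have h := (abs_nonneg _).trans (h3 0); simpa using h
  have b2 := fun k => abs_cauchyProdCoeff_sub_le (a := fun j => (gTwo (stripYT 2) ^ j * (1 + hatMZeroTwo)) 3 b)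
    (b := fun i => (gTwo (stripYT 2) ^ i) a 2) hρ0.le hρ1 ha h2 k
  have b3 := fun k => abs_cauchyProdCoeff_sub_le (a := fun j => (gTwo (stripYT 2) ^ j * (1 + hatMZeroTwo)) 3 b)
    (b := fun i => (gTwo (stripYT 2) ^ i) a 3) hρ0.le hρ1 ha h3 k
  -- absorb `ρ^{k+1}/(1 − ρ)` into `(k+1)ρ^k`
  have aux : ∀ (u v : ℝ), 0 ≤ u → ∀ k : ℕ, u * rhoTwo ^ (k + 1) / (1 - rhoTwo) + v * ((k : ℝ) + 1) * rhoTwo ^ k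
      ≤ (u * rhoTwo / (1 - rhoTwo) + v) * (((k : ℝ) + 1) * rhoTwo ^ k) := by
    intro u v hu k
    have h1 : 0 < 1 - rhoTwo := by linarith
    have hk : (1 : ℝ) ≤ (k : ℝ) + 1 := by
      have : (0 : ℝ) ≤ (k : ℝ) := Nat.cast_nonneg k
      linarith
    have e1 : u * rhoTwo ^ (k + 1) / (1 - rhoTwo) = u * rhoTwo / (1 - rhoTwo) * rhoTwo ^ k := by
      rw [pow_succ]
      ring
    have h0 : 0 ≤ u * rhoTwo / (1 - rhoTwo) * rhoTwo ^ k :=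
      mul_nonneg (div_nonneg (mul_nonneg hu hρ0.le) h1.le) (pow_nonneg hρ0.le k)
    have h2' := le_mul_of_one_le_right h0 hk
    calc u * rhoTwo ^ (k + 1) / (1 - rhoTwo) + v * ((k : ℝ) + 1) * rhoTwo ^ k
        = u * rhoTwo / (1 - rhoTwo) * rhoTwo ^ k + v * ((k : ℝ) + 1) * rhoTwo ^ k := by rw [e1]
      _ ≤ u * rhoTwo / (1 - rhoTwo) * rhoTwo ^ k * ((k : ℝ) + 1) + v * ((k : ℝ) + 1) * rhoTwo ^ k := by linarith
      _ = (u * rhoTwo / (1 - rhoTwo) + v) * (((k : ℝ) + 1) * rhoTwo ^ k) := by ring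
  set M2 : ℝ := (|limTwo 3 b| * C2 + |projTwo a 2| * Ca) * rhoTwo / (1 - rhoTwo) + Ca * C2 with hM2
  set M3 : ℝ := (|limTwo 3 b| * C3 + |projTwo a 3| * Ca) * rhoTwo / (1 - rhoTwo) + Ca * C3 with hM3
  refine ⟨hexCriticalFugacity * stripYT 2 * M2 + hexCriticalFugacity ^ 2 * stripYT 2 * M3, fun k => ?_⟩
  have hb2 := (b2 k).trans (aux _ _ (add_nonneg (mul_nonneg (abs_nonneg _) hC2) (mul_nonneg (abs_nonneg _) hCa)) k)
  have hb3 := (b3 k).trans (aux _ _ (add_nonneg (mul_nonneg (abs_nonneg _) hC3) (mul_nonneg (abs_nonneg _) hCa)) k)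
  rw [← hM2] at hb2
  rw [← hM3] at hb3
  have e : hatCD (stripYT 2) (k + 1) a b - (slopeCTwo a b * ((k : ℝ) + 1) + interceptCTwo a b)
      = hexCriticalFugacity * stripYT 2 *
          (cauchyProdCoeff (fun j => (gTwo (stripYT 2) ^ j * (1 + hatMZeroTwo)) 3 b) (fun i => (gTwo (stripYT 2) ^ i) a 2) k
            - (limTwo 3 b * projTwo a 2 * ((k : ℝ) + 1) + limTwo 3 b * ∑' j : ℕ, ((gTwo (stripYT 2) ^ j) a 2 - projTwo a 2)
              + projTwo a 2 * ∑' i : ℕ, ((gTwo (stripYT 2) ^ i * (1 + hatMZeroTwo)) 3 b - limTwo 3 b)))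
        + hexCriticalFugacity ^ 2 * stripYT 2 *
          (cauchyProdCoeff (fun j => (gTwo (stripYT 2) ^ j * (1 + hatMZeroTwo)) 3 b) (fun i => (gTwo (stripYT 2) ^ i) a 3) k
            - (limTwo 3 b * projTwo a 3 * ((k : ℝ) + 1) + limTwo 3 b * ∑' j : ℕ, ((gTwo (stripYT 2) ^ j) a 3 - projTwo a 3)
              + projTwo a 3 * ∑' i : ℕ, ((gTwo (stripYT 2) ^ i * (1 + hatMZeroTwo)) 3 b - limTwo 3 b))) := by
    rw [hatCD_two_succ_apply_eq hy, slopeCTwo, interceptCTwo, devGSumTwo, devGSumTwo, devDSumTwo]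
    ring
  rw [e]
  have hxy : 0 < hexCriticalFugacity * stripYT 2 := mul_pos hx hy
  have hx2y : 0 < hexCriticalFugacity ^ 2 * stripYT 2 := by positivity
  refine (abs_add_le _ _).trans ?_
  rw [abs_mul (hexCriticalFugacity * stripYT 2), abs_mul (hexCriticalFugacity ^ 2 * stripYT 2), abs_of_pos hxy, abs_of_pos hx2y]
  calc hexCriticalFugacity * stripYT 2 * _ + hexCriticalFugacity ^ 2 * stripYT 2 * _
      ≤ hexCriticalFugacity * stripYT 2 * (M2 * (((k : ℝ) + 1) * rhoTwo ^ k))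
        + hexCriticalFugacity ^ 2 * stripYT 2 * (M3 * (((k : ℝ) + 1) * rhoTwo ^ k)) :=
        add_le_add (mul_le_mul_of_nonneg_left hb2 hxy.le) (mul_le_mul_of_nonneg_left hb3 hx2y.le)
    _ = (hexCriticalFugacity * stripYT 2 * M2 + hexCriticalFugacity ^ 2 * stripYT 2 * M3) * ((k : ℝ) + 1) * rhoTwo ^ k := by ring

/-! ## §4 Second-order asymptotics of the squared-contact sums -/

/-- ★ **The unrolled squared-contact sums**: `Ĉ²_D(k+1) = Σ_{j ≤ k} G^{k−j}·K₁·(G^j·P + 2·Ĉ_D(j))` for every `k` (`0 < y`; `P = 1 + M̂(0)`) —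
induction on «WIDTH-TWO CONTACT RECURSION» `hatC2D_two_succ` with `D̂(j) = G^jP` (`j ≥ 1`), base `Ĉ²_D(1) = K₁P`, `Ĉ_D(0) = 0`.
[cite: Feller1968, XIII.6 (second moments by the renewal argument); lane «pcv-sawmu» a-p2 g27 — own] -/
theorem hatC2D_two_eq_sum {y : ℝ} (hy : 0 < y) (k : ℕ) :
    hatC2D y (k + 1) = ∑ j ∈ Finset.range (k + 1), gTwo y ^ (k - j) * kOneTwo y * (gTwo y ^ j * (1 + hatMZeroTwo) + (2 : ℝ) • hatCD y j) := by
  induction k with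
  | zero =>
    rw [Finset.sum_range_one, Nat.sub_self, pow_zero, Matrix.one_mul, Matrix.one_mul, hatCD_two_zero hy, smul_zero, add_zero,
      hatC2D_two_one hy]
  | succ k ih =>
    rw [hatC2D_two_succ hy (by omega), ih, hatD_two_eq_pow_mul hy.le (by omega),
      Finset.sum_range_succ (fun j => gTwo y ^ (k + 1 - j) * kOneTwo y * (gTwo y ^ j * (1 + hatMZeroTwo) + (2 : ℝ) • hatCD y j)) (k + 1),
      Nat.sub_self, pow_zero, Matrix.one_mul, Finset.mul_sum, Matrix.mul_add (kOneTwo y), Matrix.mul_smul, add_assoc]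
    congr 1
    refine Finset.sum_congr rfl fun j hj => ?_
    rw [Finset.mem_range] at hj
    rw [show k + 1 - j = k - j + 1 by omega, pow_succ']
    simp only [Matrix.mul_assoc]

/-- ★ **The squared-contact sums as two Cauchy products** (any `y > 0`): with `a_j := (G^jP)_{3b} + 2·Ĉ_D(j)_{3b}`,
`Ĉ²_D(k+1)_{ab} = x y·Σ_{j≤k} a_j (G^{k−j})_{a2} + x² y·Σ_{j≤k} a_j (G^{k−j})_{a3}`. [cite: Feller1968, XIII.6; lane «pcv-sawmu» a-p2 g27 — own] -/
theorem hatC2D_two_succ_apply_eq {y : ℝ} (hy : 0 < y) (k : ℕ) (a b : Fin (2 * 2)) :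
    hatC2D y (k + 1) a b =
      hexCriticalFugacity * y * cauchyProdCoeff (fun j => (gTwo y ^ j * (1 + hatMZeroTwo)) 3 b + 2 * hatCD y j 3 b) (fun i => (gTwo y ^ i) a 2) k +
        hexCriticalFugacity ^ 2 * y * cauchyProdCoeff (fun j => (gTwo y ^ j * (1 + hatMZeroTwo)) 3 b + 2 * hatCD y j 3 b)
          (fun i => (gTwo y ^ i) a 3) k := by
  rw [hatC2D_two_eq_sum hy, Matrix.sum_apply, cauchyProdCoeff, cauchyProdCoeff, Finset.mul_sum, Finset.mul_sum, ← Finset.sum_add_distrib]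
  refine Finset.sum_congr rfl fun j _ => ?_
  rw [mul_kOneTwo_mul_apply]
  simp only [Matrix.add_apply, Matrix.smul_apply, smul_eq_mul]
  ring

/-- ★ The second-order hypothesis for the sequence `a_j = (G^jP)_{3b} + 2·Ĉ_D(j)_{3b}`: `∃ C, ∀ j, |a_j − (aOneTwo b·(j+1) + aZeroTwo b)| ≤ C(j+1)ρ^j`
(geometric convergence of `(G^jP)_{3b}` + §3 for `Ĉ_D(j)_{3b}`; `j = 0` absorbed in the constant). [cite: Feller1968, XIII.6; lane «pcv-sawmu» a-p2 g27 — own] -/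
theorem exists_aSeqTwo_abs_le (b : Fin (2 * 2)) :
    ∃ C : ℝ, ∀ j : ℕ, |(gTwo (stripYT 2) ^ j * (1 + hatMZeroTwo)) 3 b + 2 * hatCD (stripYT 2) j 3 b - (aOneTwo b * ((j : ℝ) + 1) + aZeroTwo b)|
      ≤ C * ((j : ℝ) + 1) * rhoTwo ^ j := by
  obtain ⟨hr0, hrρ, hρ1, hρ0⟩ := rhoTwo_facts
  obtain ⟨Cd, hd⟩ := exists_gTwo_pow_mul_sub_abs_le (1 + hatMZeroTwo) 3 b
  simp only [projTwo_mul_one_add] at hd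
  obtain ⟨Cc, hc⟩ := exists_hatCD_two_sub_linear_abs_le 3 b
  have hCd : 0 ≤ Cd := by have h := (abs_nonneg _).trans (hd 0); simpa using h
  have hCc : 0 ≤ Cc := by have h := (abs_nonneg _).trans (hc 0); simpa using h
  set K0 : ℝ := |(1 + hatMZeroTwo) 3 b + 2 * hatCD (stripYT 2) 0 3 b - (aOneTwo b + aZeroTwo b)| with hK0
  refine ⟨max K0 (Cd + 2 * Cc / rhoTwo), fun j => ?_⟩
  rcases j with _ | m
  · have h0 : K0 ≤ max K0 (Cd + 2 * Cc / rhoTwo) := le_max_left _ _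
    have e0 : |(gTwo (stripYT 2) ^ (0 : ℕ) * (1 + hatMZeroTwo)) 3 b + 2 * hatCD (stripYT 2) 0 3 b
        - (aOneTwo b * (((0 : ℕ) : ℝ) + 1) + aZeroTwo b)| = K0 := by
      rw [hK0, pow_zero, Matrix.one_mul, Nat.cast_zero, zero_add, mul_one]
    rw [e0, Nat.cast_zero, zero_add, mul_one, pow_zero, mul_one]
    exact h0
  · have e : (gTwo (stripYT 2) ^ (m + 1) * (1 + hatMZeroTwo)) 3 b + 2 * hatCD (stripYT 2) (m + 1) 3 b
        - (aOneTwo b * (((m + 1 : ℕ) : ℝ) + 1) + aZeroTwo b)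
        = ((gTwo (stripYT 2) ^ (m + 1) * (1 + hatMZeroTwo)) 3 b - limTwo 3 b)
          + 2 * (hatCD (stripYT 2) (m + 1) 3 b - (slopeCTwo 3 b * ((m : ℝ) + 1) + interceptCTwo 3 b)) := by
      rw [aOneTwo, aZeroTwo]; push_cast; ring
    rw [e]
    have h1 := hd (m + 1)
    have h2 := hc m
    have hm0 : (0 : ℝ) ≤ (m : ℝ) := Nat.cast_nonneg m
    have hρm : 0 ≤ rhoTwo ^ (m + 1) := pow_nonneg hρ0.le _
    have hρm' : 0 ≤ rhoTwo ^ m := pow_nonneg hρ0.le _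
    have step : |((gTwo (stripYT 2) ^ (m + 1) * (1 + hatMZeroTwo)) 3 b - limTwo 3 b)
        + 2 * (hatCD (stripYT 2) (m + 1) 3 b - (slopeCTwo 3 b * ((m : ℝ) + 1) + interceptCTwo 3 b))|
        ≤ (Cd + 2 * Cc / rhoTwo) * ((((m + 1 : ℕ) : ℝ)) + 1) * rhoTwo ^ (m + 1) := by
      refine (abs_add_le _ _).trans ?_
      rw [abs_mul, abs_two]
      push_cast
      have hA : Cd * rhoTwo ^ (m + 1) ≤ Cd * (((m : ℝ) + 1 + 1) * rhoTwo ^ (m + 1)) := by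
        apply mul_le_mul_of_nonneg_left _ hCd
        nlinarith
      have hB : 2 * (Cc * ((m : ℝ) + 1) * rhoTwo ^ m) ≤ 2 * Cc / rhoTwo * (((m : ℝ) + 1 + 1) * rhoTwo ^ (m + 1)) := by
        have e2 : 2 * Cc / rhoTwo * (((m : ℝ) + 1 + 1) * rhoTwo ^ (m + 1)) = 2 * (Cc * ((m : ℝ) + 1 + 1) * rhoTwo ^ m) := by
          rw [pow_succ]
          field_simp
        rw [e2]
        have : Cc * ((m : ℝ) + 1) * rhoTwo ^ m ≤ Cc * ((m : ℝ) + 1 + 1) * rhoTwo ^ m := by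
          have := mul_nonneg hCc hρm'
          nlinarith
        linarith
      calc |(gTwo (stripYT 2) ^ (m + 1) * (1 + hatMZeroTwo)) 3 b - limTwo 3 b|
            + 2 * |hatCD (stripYT 2) (m + 1) 3 b - (slopeCTwo 3 b * ((m : ℝ) + 1) + interceptCTwo 3 b)|
          ≤ Cd * rhoTwo ^ (m + 1) + 2 * (Cc * ((m : ℝ) + 1) * rhoTwo ^ m) := by linarith
        _ ≤ Cd * (((m : ℝ) + 1 + 1) * rhoTwo ^ (m + 1)) + 2 * Cc / rhoTwo * (((m : ℝ) + 1 + 1) * rhoTwo ^ (m + 1)) := add_le_add hA hB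
        _ = (Cd + 2 * Cc / rhoTwo) * ((m : ℝ) + 1 + 1) * rhoTwo ^ (m + 1) := by ring
    refine step.trans ?_
    have hpos : 0 ≤ ((((m + 1 : ℕ) : ℝ)) + 1) * rhoTwo ^ (m + 1) := by positivity
    have := mul_le_mul_of_nonneg_right (le_max_right K0 (Cd + 2 * Cc / rhoTwo)) hpos
    linarith [this]

/-- ★★ **SECOND-ORDER ASYMPTOTICS OF THE SQUARED-CONTACT SUMS OF `S₂` AT CRITICALITY**: for all levels `a, b`,
`Ĉ²_D(k+1)_{ab} − (quadQTwo a b·(k+1)(k+2) + linQTwo a b·(k+1)) → constQTwo a b` — §1's second-order convolution lemma on the two Cauchy products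
of `hatC2D_two_succ_apply_eq`, with `exists_aSeqTwo_abs_le` and the geometric convergence of the powers of `G`.
[cite: Feller1968, XIII.6 (E N_k² to order one); Stanley2012EC1, §4.1 Theorem 4.1.1 (iii); lane «pcv-sawmu» a-p2 g27 — own result, not in print] -/
theorem tendsto_hatC2D_two_sub_quadratic (a b : Fin (2 * 2)) :
    Tendsto (fun k : ℕ => hatC2D (stripYT 2) (k + 1) a b - (quadQTwo a b * ((k : ℝ) + 1) * ((k : ℝ) + 2) + linQTwo a b * ((k : ℝ) + 1)))
      atTop (𝓝 (constQTwo a b)) := by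
  obtain ⟨hr0, hrρ, hρ1, hρ0⟩ := rhoTwo_facts
  have hy : 0 < stripYT 2 := stripYT_pos (by norm_num)
  obtain ⟨Ca, ha⟩ := exists_aSeqTwo_abs_le b
  obtain ⟨C2, h2⟩ := exists_gTwo_pow_mul_sub_abs_le 1 a 2
  obtain ⟨C3, h3⟩ := exists_gTwo_pow_mul_sub_abs_le 1 a 3
  simp only [Matrix.mul_one] at h2 h3
  have t2 := tendsto_cauchyProdCoeff_sub_quadratic
    (a := fun j => (gTwo (stripYT 2) ^ j * (1 + hatMZeroTwo)) 3 b + 2 * hatCD (stripYT 2) j 3 b)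
    (b := fun i => (gTwo (stripYT 2) ^ i) a 2) hρ0.le hρ1 ha h2
  have t3 := tendsto_cauchyProdCoeff_sub_quadratic
    (a := fun j => (gTwo (stripYT 2) ^ j * (1 + hatMZeroTwo)) 3 b + 2 * hatCD (stripYT 2) j 3 b)
    (b := fun i => (gTwo (stripYT 2) ^ i) a 3) hρ0.le hρ1 ha h3
  have t := (t2.const_mul (hexCriticalFugacity * stripYT 2)).add (t3.const_mul (hexCriticalFugacity ^ 2 * stripYT 2))
  have hL : hexCriticalFugacity * stripYT 2 *
        (aZeroTwo b * ∑' j, ((fun i => (gTwo (stripYT 2) ^ i) a 2) j - projTwo a 2)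
          - aOneTwo b * ∑' j : ℕ, (j : ℝ) * ((fun i => (gTwo (stripYT 2) ^ i) a 2) j - projTwo a 2)
          + projTwo a 2 * ∑' i : ℕ, ((fun j => (gTwo (stripYT 2) ^ j * (1 + hatMZeroTwo)) 3 b + 2 * hatCD (stripYT 2) j 3 b) i
              - aOneTwo b * ((i : ℝ) + 1) - aZeroTwo b))
      + hexCriticalFugacity ^ 2 * stripYT 2 *
        (aZeroTwo b * ∑' j, ((fun i => (gTwo (stripYT 2) ^ i) a 3) j - projTwo a 3)
          - aOneTwo b * ∑' j : ℕ, (j : ℝ) * ((fun i => (gTwo (stripYT 2) ^ i) a 3) j - projTwo a 3)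
          + projTwo a 3 * ∑' i : ℕ, ((fun j => (gTwo (stripYT 2) ^ j * (1 + hatMZeroTwo)) 3 b + 2 * hatCD (stripYT 2) j 3 b) i
              - aOneTwo b * ((i : ℝ) + 1) - aZeroTwo b))
      = constQTwo a b := by
    rw [constQTwo, chiTwo, devGMomTwo, devGMomTwo, psiTwo, devGSumTwo, devGSumTwo, devQSumTwo, phiTwo]
    ring
  rw [hL] at t
  refine t.congr fun k => ?_
  rw [hatC2D_two_succ_apply_eq hy, quadQTwo, linQTwo, psiTwo, devGSumTwo, devGSumTwo, phiTwo]
  ring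

/-! ## §5 The exact constants -/

/-- ★ **The rank-one identity** `φ₃·A_{ab} = A_{3b}·φ_a` for all `a, b` (`Π = u ⊗ w/(w·u)` has rank one, `A = Π·P`, `φ_a = x y (Π·(E₂ + xE₃))_a`): this is what
makes the slope of the mean and the rate of the variance INDEPENDENT of the end levels.  Sixteen polynomial identities modulo `2x⁴ − 4x² + 1 = 0`.
[cite: Seneta1973, §1.4 (rank-one Perron projection); lane «pcv-sawmu» a-p2 g27 — own computation] -/
theorem limTwo_three_mul_phiTwo (a b : Fin (2 * 2)) : phiTwo 3 * limTwo a b = limTwo 3 b * phiTwo a := by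
  have hP := xc_minpoly
  have hy := seven_mul_stripYT_two
  set x := hexCriticalFugacity with hx
  set y := stripYT 2 with hydef
  fin_cases a <;> fin_cases b <;> simp [phiTwo, limTwo, projTwo, ← hx]
    <;> first
      | linear_combination
      | linear_combination ((-39/14 : ℝ) * x + (12/7 : ℝ) * x ^ 3) * hP + ((-3/28 : ℝ) * x + (3/7 : ℝ) * x ^ 3 + (-3/14 : ℝ) * x ^ 5) * hy
      | linear_combination ((13/14 : ℝ) * x ^ 2 + (-4/7 : ℝ) * x ^ 4) * hP + ((1/28 : ℝ) * x ^ 2 + (-1/7 : ℝ) * x ^ 4 + (1/14 : ℝ) * x ^ 6) * hy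
      | linear_combination ((13/14 : ℝ) * x ^ 3 + (-4/7 : ℝ) * x ^ 5) * hP + ((1/28 : ℝ) * x ^ 3 + (-1/7 : ℝ) * x ^ 5 + (1/14 : ℝ) * x ^ 7) * hy
      | linear_combination ((-39/14 : ℝ) * x ^ 2 + (12/7 : ℝ) * x ^ 4) * hP + ((-3/28 : ℝ) * x ^ 2 + (3/7 : ℝ) * x ^ 4 + (-3/14 : ℝ) * x ^ 6) * hy
      | linear_combination ((39/14 : ℝ) * x + (-116/7 : ℝ) * x ^ 3 + (64/7 : ℝ) * x ^ 5) * hP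
        + ((3/28 : ℝ) * x + (-1 : ℝ) * x ^ 3 + (5/2 : ℝ) * x ^ 5 + (-8/7 : ℝ) * x ^ 7) * hy
      | linear_combination ((13/14 : ℝ) * x + (165/7 : ℝ) * x ^ 3 + (-104/7 : ℝ) * x ^ 5) * hP
        + ((1/28 : ℝ) * x + (11/14 : ℝ) * x ^ 3 + (-51/14 : ℝ) * x ^ 5 + (13/7 : ℝ) * x ^ 7) * hy
      | linear_combination ((39/14 : ℝ) * x ^ 2 + (-116/7 : ℝ) * x ^ 4 + (64/7 : ℝ) * x ^ 6) * hP
        + ((3/28 : ℝ) * x ^ 2 + (-1 : ℝ) * x ^ 4 + (5/2 : ℝ) * x ^ 6 + (-8/7 : ℝ) * x ^ 8) * hy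
      | linear_combination ((-117/14 : ℝ) * x + (179/7 : ℝ) * x ^ 3 + (-88/7 : ℝ) * x ^ 5) * hP
        + ((-9/28 : ℝ) * x + (29/14 : ℝ) * x ^ 3 + (-53/14 : ℝ) * x ^ 5 + (11/7 : ℝ) * x ^ 7) * hy
      | linear_combination ((65/7 : ℝ) * x ^ 2 + (-183/7 : ℝ) * x ^ 4 + (88/7 : ℝ) * x ^ 6) * hP
        + ((5/14 : ℝ) * x ^ 2 + (-31/14 : ℝ) * x ^ 4 + (27/7 : ℝ) * x ^ 6 + (-11/7 : ℝ) * x ^ 8) * hy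

/-- `q_{ab}·A_{ab} = μ₁²` (`μ₁ = slopeCTwo a b`): the quadratic terms of `Ĉ²_D/D̂` and `(Ĉ_D/D̂)²` cancel. [cite: Feller1968, XIII.6; lane «pcv-sawmu» a-p2 g27] -/
theorem quadQTwo_mul_limTwo (a b : Fin (2 * 2)) : quadQTwo a b * limTwo a b = slopeCTwo a b ^ 2 := by
  have R1 := limTwo_three_mul_phiTwo a b
  rw [quadQTwo, aOneTwo, slopeCTwo_eq, slopeCTwo_eq]
  linear_combination (limTwo 3 b * phiTwo a) * R1

/-- ★ **The variance-rate identity**: `(q_{ab} + ℓ_{ab})·A_{ab} − 2μ₁μ₀ = φ₃(1 − φ₃ + 2ψ₃)·A_{ab}²` for ALL `a, b` — the linear coefficient of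
`A·Var` is a universal multiple of `A²` (by the rank-one identity), so the variance rate does not depend on the end levels.
[cite: Feller1968, XIII.6 (Var N_k ∼ (σ²/μ³)k); lane «pcv-sawmu» a-p2 g27 — own computation] -/
theorem varRate_identity (a b : Fin (2 * 2)) :
    (quadQTwo a b + linQTwo a b) * limTwo a b - 2 * slopeCTwo a b * interceptCTwo a b
      = phiTwo 3 * (1 - phiTwo 3 + 2 * psiTwo 3) * limTwo a b ^ 2 := by
  have R1 := limTwo_three_mul_phiTwo a b
  rw [quadQTwo, linQTwo, aOneTwo, aZeroTwo, slopeCTwo_eq, slopeCTwo_eq, interceptCTwo_eq, interceptCTwo_eq]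
  linear_combination (-(phiTwo 3 * limTwo a b + limTwo a b + 2 * psiTwo 3 * limTwo a b - 2 * phiTwo 3 * limTwo a b
    - 2 * limTwo 3 b * psiTwo a - 2 * phiTwo a * devDSumTwo b)) * R1

/-- ★ `φ₃ = ½ + x² = (3 − √2)/2` (`= 2θ₂`, twice the contact density of «CONTACT-DENSITY»: two steps per hat index). [cite: Feller1968, XIII.6; lane «pcv-sawmu» a-p2 g27] -/
theorem phiTwo_three_eq : phiTwo 3 = 1 / 2 + hexCriticalFugacity ^ 2 ∧ phiTwo 3 = (3 - Real.sqrt 2) / 2 := by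
  have hP := xc_minpoly
  have hy := seven_mul_stripYT_two
  set x := hexCriticalFugacity with hx
  set y := stripYT 2 with hydef
  have h1 : phiTwo 3 = 1 / 2 + x ^ 2 := by
    simp [phiTwo, projTwo, ← hx, ← hydef]
    linear_combination ((-1/2 : ℝ) + (44/7 : ℝ) * x ^ 2) * hP + ((5/14 : ℝ) * x ^ 2 + (-11/14 : ℝ) * x ^ 4) * hy
  refine ⟨h1, ?_⟩
  rw [h1, sqrt_two_eq, ← hx]
  ring

/-- `1 + p + κ = (8 − 6x²)/7 > 0`. [cite: Stanley2012EC1, §4.1; lane plumbing] -/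
theorem one_add_pTwo_add_kTwo_pos : 0 < 1 + pTwo + kTwo := by
  obtain ⟨h1, h2⟩ := xc_sq_bounds
  rw [pTwo, kTwo]
  linarith

/-- ★ **Closed form of the deviation series** (times `1 + p + κ`): `(Σ'_i ((G^i)_{ac} − Π_{ac}))·(1+p+κ) = (δ_{ac} − Π_{ac})(1+p+κ) + (1+p)N_{ac} + (N²)_{ac}` —
the terms are `(N^i)_{ac}` for `i ≥ 1` and `N³ = −pN² − κN` turns the tail into a linear equation for the sum.
[cite: Stanley2012EC1, §4.1 Theorem 4.1.1; lane «pcv-sawmu» a-p2 g27 — own] -/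
theorem devGSumTwo_mul_eq (a c : Fin (2 * 2)) :
    devGSumTwo a c * (1 + pTwo + kTwo)
      = ((1 : Matrix (Fin (2 * 2)) (Fin (2 * 2)) ℝ) a c - projTwo a c) * (1 + pTwo + kTwo) + ((1 + pTwo) * nilTwo a c + (nilTwo * nilTwo) a c) := by
  obtain ⟨hr0, hrρ, hρ1, hρ0⟩ := rhoTwo_facts
  set f : ℕ → ℝ := fun i => (gTwo (stripYT 2) ^ i) a c - projTwo a c with hf
  obtain ⟨C, hC⟩ := exists_gTwo_pow_mul_sub_abs_le 1 a c
  simp only [Matrix.mul_one] at hC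
  have hs : Summable f := summable_of_abs_le_geometric hρ0.le hρ1 hC
  -- the terms for `i ≥ 1` are the entries of the powers of `N`
  have hfN : ∀ i : ℕ, f (i + 1) = (nilTwo ^ (i + 1)) a c := fun i => by
    simp only [hf, nilTwo_pow_succ, Matrix.sub_apply]
  have hrec : ∀ i : ℕ, f (i + 3) = -pTwo * f (i + 2) - kTwo * f (i + 1) := fun i => by
    rw [hfN (i + 2), hfN (i + 1), hfN i]
    have h := nil_seq_rec_mul 1 a c i
    simp only [Matrix.mul_one] at h
    exact h
  have e0 : ∑' i, f i = f 0 + ∑' i, f (i + 1) := hs.tsum_eq_zero_add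
  have hs1 : Summable fun i => f (i + 1) := hs.comp_injective (add_left_injective 1)
  have hs2 : Summable fun i => f (i + 2) := hs.comp_injective (add_left_injective 2)
  have e1 : ∑' i, f (i + 1) = f 1 + ∑' i, f (i + 2) := hs1.tsum_eq_zero_add
  have e2 : ∑' i, f (i + 2) = f 2 + ∑' i, f (i + 3) := hs2.tsum_eq_zero_add
  have e3 : ∑' i, f (i + 3) = -pTwo * ∑' i, f (i + 2) - kTwo * ∑' i, f (i + 1) := by
    rw [← tsum_mul_left, ← tsum_mul_left, ← (hs2.mul_left _).tsum_sub (hs1.mul_left _)]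
    exact tsum_congr hrec
  have hdev : devGSumTwo a c = ∑' i, f i := rfl
  have hf0 : f 0 = (1 : Matrix (Fin (2 * 2)) (Fin (2 * 2)) ℝ) a c - projTwo a c := by simp only [hf, pow_zero]
  have hf1 : f 1 = nilTwo a c := by simpa using hfN 0
  have hf2 : f 2 = (nilTwo * nilTwo) a c := by simpa [pow_two] using hfN 1
  -- solve the linear equation for `U = Σ' f (i+1)`
  have hU : (∑' i, f (i + 1)) * (1 + pTwo + kTwo) = (1 + pTwo) * f 1 + f 2 := by
    linear_combination (1 + pTwo) * e1 + e2 + e3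
  rw [hdev, e0, add_mul, hU, hf0, hf1, hf2]

/-- ★ `ψ₃ = −9/4 + 8x² = 23/4 − 4√2` (`= 0.09314575…`): the deviation functional of the surface row in closed form. [cite: Feller1968, XIII.6; lane «pcv-sawmu» a-p2 g27 — own computation] -/
theorem psiTwo_three_eq : psiTwo 3 = -9 / 4 + 8 * hexCriticalFugacity ^ 2 ∧ psiTwo 3 = 23 / 4 - 4 * Real.sqrt 2 := by
  have hP := xc_minpoly
  have hy := seven_mul_stripYT_two
  have hne : (1 + pTwo + kTwo) ≠ 0 := one_add_pTwo_add_kTwo_pos.ne'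
  have h1 : psiTwo 3 = -9 / 4 + 8 * hexCriticalFugacity ^ 2 := by
    apply mul_right_cancel₀ hne
    have e : psiTwo 3 * (1 + pTwo + kTwo) = hexCriticalFugacity * stripYT 2 * (devGSumTwo 3 2 * (1 + pTwo + kTwo))
        + hexCriticalFugacity ^ 2 * stripYT 2 * (devGSumTwo 3 3 * (1 + pTwo + kTwo)) := by
      rw [psiTwo]; ring
    rw [e, devGSumTwo_mul_eq, devGSumTwo_mul_eq]
    set x := hexCriticalFugacity with hx
    set y := stripYT 2 with hydef
    simp [nilTwo, gTwo, projTwo, pTwo, kTwo, Matrix.mul_apply, Fin.sum_univ_four, ← hx, ← hydef]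
    linear_combination ((18/7 : ℝ) + (-571/98 : ℝ) * x ^ 2 + (-12387/343 : ℝ) * x ^ 4 + (10520/343 : ℝ) * x ^ 6 + (-2048/343 : ℝ) * x ^ 8) * hP
      + ((-19/98 : ℝ) * x ^ 2 + (-465/686 : ℝ) * x ^ 4 + (-29/49 : ℝ) * x ^ 4 * y + (4027/686 : ℝ) * x ^ 6 + (102/49 : ℝ) * x ^ 6 * y + (1/7 : ℝ) * x ^ 6 * y ^ 2 + (-1411/343 : ℝ) * x ^ 8 + (-16/49 : ℝ) * x ^ 8 * y + (256/343 : ℝ) * x ^ 10) * hy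
  refine ⟨h1, ?_⟩
  rw [h1, sqrt_two_eq]
  ring

/-- ★ **THE RATE**: `φ₃·(1 − φ₃ + 2ψ₃) = (96 − 67√2)/4` (`= 0.3119228…`). [cite: Feller1968, XIII.6; lane «pcv-sawmu» a-p2 g27 — own computation] -/
theorem varRateHat_eq : phiTwo 3 * (1 - phiTwo 3 + 2 * psiTwo 3) = (96 - 67 * Real.sqrt 2) / 4 := by
  have hP := xc_minpoly
  set x := hexCriticalFugacity with hx
  rw [phiTwo_three_eq.1, psiTwo_three_eq.1, sqrt_two_eq, ← hx]
  linear_combination ((15/2 : ℝ)) * hP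

/-- Every entry of the limit matrix `A = limTwo` is positive (`0.29 < x² < 0.30`). [cite: Feller1968, XIII.10; lane plumbing] -/
theorem limTwo_pos (a b : Fin (2 * 2)) : 0 < limTwo a b := by
  obtain ⟨h1, h2⟩ := xc_sq_bounds
  have hx : 0 < hexCriticalFugacity := hexCriticalFugacity_pos_lt_one.1
  set x := hexCriticalFugacity with hx'
  have p1 : 0 < x * (1 - 2 * x ^ 2) := mul_pos hx (by linarith)
  have p2 : 0 < x * (1 - 3 * x ^ 2) := mul_pos hx (by linarith)
  have p3 : 0 < x * (3 / 2 - 4 * x ^ 2) := mul_pos hx (by linarith)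
  have p4 : 0 < x * (3 - 2 * x ^ 2) := mul_pos hx (by linarith)
  have p5 : 0 < x * (5 / 2 - 11 / 2 * x ^ 2) := mul_pos hx (by linarith)
  fin_cases a <;> fin_cases b <;> simp [limTwo, ← hx'] <;> nlinarith [p1, p2, p3, p4, p5, h1, h2, hx]

/-! ## §6 The variance of the contact count is linear in the length -/

/-- The mean number of surface contacts of a bridge `a → b` of `S₂` with hat index `k`, under the critical weights `x_c^{|ω|} y₂^{#top}`:
`Ĉ_D(k)_{ab}/D̂(k)_{ab}`. [cite: Feller1968, XIII.6; DuminilCopinHammond2013, §2.2; lane «pcv-sawmu» a-p2 g27] -/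
def meanTopTwo (k : ℕ) (a b : Fin (2 * 2)) : ℝ := hatCD (stripYT 2) k a b / hatD 2 (stripYT 2) k a b

/-- The variance of the number of surface contacts of a bridge `a → b` of `S₂` with hat index `k` under the critical weights:
`Ĉ²_D(k)_{ab}/D̂(k)_{ab} − (Ĉ_D(k)_{ab}/D̂(k)_{ab})²`. [cite: Feller1968, XIII.6; DuminilCopinHammond2013, §2.2; lane «pcv-sawmu» a-p2 g27] -/
def varTopTwo (k : ℕ) (a b : Fin (2 * 2)) : ℝ := hatC2D (stripYT 2) k a b / hatD 2 (stripYT 2) k a b - meanTopTwo k a b ^ 2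

/-- The intercept of the linear variance law: `V_{ab} = (constQTwo a b·A_{ab} − interceptCTwo a b²)/A_{ab}²` (e.g. `V₀₀ = −0.94026`, `V₂₂ = −0.48263`).
[cite: Feller1968, XIII.6; lane «pcv-sawmu» a-p2 g27] -/
def varInterceptTwo (a b : Fin (2 * 2)) : ℝ := (constQTwo a b * limTwo a b - interceptCTwo a b ^ 2) / limTwo a b ^ 2

/-- `(k+1)²·(D̂(k+1)_{ab} − A_{ab}) → 0` (geometric convergence beats any polynomial). [cite: Feller1968, XIII.10; lane plumbing] -/
theorem tendsto_sq_mul_hatD_sub (a b : Fin (2 * 2)) :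
    Tendsto (fun k : ℕ => ((k : ℝ) + 1) ^ 2 * (hatD 2 (stripYT 2) (k + 1) a b - limTwo a b)) atTop (𝓝 0) := by
  obtain ⟨hr0, hrρ, hρ1, hρ0⟩ := rhoTwo_facts
  have hy : 0 < stripYT 2 := stripYT_pos (by norm_num)
  obtain ⟨C, hC⟩ := exists_gTwo_pow_mul_sub_abs_le (1 + hatMZeroTwo) a b
  simp only [projTwo_mul_one_add] at hC
  have h2 : Tendsto (fun k : ℕ => (k : ℝ) ^ 2 * rhoTwo ^ k) atTop (𝓝 0) := by
    simpa using tendsto_pow_const_mul_const_pow_of_lt_one 2 hρ0.le hρ1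
  have h2' : Tendsto (fun k : ℕ => C * ((((k + 1 : ℕ) : ℝ)) ^ 2 * rhoTwo ^ (k + 1))) atTop (𝓝 0) := by
    have := (h2.comp (tendsto_add_atTop_nat 1)).const_mul C
    simpa using this
  refine squeeze_zero_norm (fun k => ?_) h2'
  rw [Real.norm_eq_abs, abs_mul, hatD_two_eq_pow_mul hy.le (by omega : 1 ≤ k + 1)]
  push_cast
  rw [abs_of_nonneg (by positivity : (0 : ℝ) ≤ ((k : ℝ) + 1) ^ 2)]
  have := hC (k + 1)
  calc ((k : ℝ) + 1) ^ 2 * |(gTwo (stripYT 2) ^ (k + 1) * (1 + hatMZeroTwo)) a b - limTwo a b|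
      ≤ ((k : ℝ) + 1) ^ 2 * (C * rhoTwo ^ (k + 1)) := mul_le_mul_of_nonneg_left this (by positivity)
    _ = C * (((k : ℝ) + 1) ^ 2 * rhoTwo ^ (k + 1)) := by ring

/-- `(k+1)·(Ĉ_D(k+1)_{ab} − (μ₁(k+1) + μ₀)) → 0`. [cite: Feller1968, XIII.6; lane plumbing] -/
theorem tendsto_mul_hatCD_sub (a b : Fin (2 * 2)) :
    Tendsto (fun k : ℕ => ((k : ℝ) + 1) * (hatCD (stripYT 2) (k + 1) a b - (slopeCTwo a b * ((k : ℝ) + 1) + interceptCTwo a b))) atTop (𝓝 0) := by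
  obtain ⟨hr0, hrρ, hρ1, hρ0⟩ := rhoTwo_facts
  obtain ⟨C, hC⟩ := exists_hatCD_two_sub_linear_abs_le a b
  have h2 : Tendsto (fun k : ℕ => (k : ℝ) ^ 2 * rhoTwo ^ k) atTop (𝓝 0) := by
    simpa using tendsto_pow_const_mul_const_pow_of_lt_one 2 hρ0.le hρ1
  have h1 : Tendsto (fun k : ℕ => (k : ℝ) * rhoTwo ^ k) atTop (𝓝 0) := by
    simpa using tendsto_self_mul_const_pow_of_lt_one hρ0.le hρ1
  have h0 : Tendsto (fun k : ℕ => rhoTwo ^ k) atTop (𝓝 0) := tendsto_pow_atTop_nhds_zero_of_lt_one hρ0.le hρ1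
  have hb : Tendsto (fun k : ℕ => C * (((k : ℝ) + 1) ^ 2 * rhoTwo ^ k)) atTop (𝓝 0) := by
    have e : (fun k : ℕ => C * (((k : ℝ) + 1) ^ 2 * rhoTwo ^ k)) = fun k : ℕ => C * ((k : ℝ) ^ 2 * rhoTwo ^ k) + 2 * C * ((k : ℝ) * rhoTwo ^ k)
        + C * rhoTwo ^ k := by
      funext k; ring
    rw [e]
    have := ((h2.const_mul C).add (h1.const_mul (2 * C))).add (h0.const_mul C)
    simpa using this
  refine squeeze_zero_norm (fun k => ?_) hb
  rw [Real.norm_eq_abs, abs_mul, abs_of_nonneg (by positivity : (0 : ℝ) ≤ (k : ℝ) + 1)]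
  calc ((k : ℝ) + 1) * |hatCD (stripYT 2) (k + 1) a b - (slopeCTwo a b * ((k : ℝ) + 1) + interceptCTwo a b)|
      ≤ ((k : ℝ) + 1) * (C * ((k : ℝ) + 1) * rhoTwo ^ k) := mul_le_mul_of_nonneg_left (hC k) (by positivity)
    _ = C * (((k : ℝ) + 1) ^ 2 * rhoTwo ^ k) := by ring

/-- ★★★ **THE VARIANCE OF THE NUMBER OF SURFACE CONTACTS OF A LONG CRITICAL BRIDGE OF `S₂` IS LINEAR IN ITS LENGTH, WITH THE UNIVERSAL RATE
`(96 − 67√2)/4` PER HAT INDEX**: for all end levels `a, b`, `varTopTwo (k+1) a b − ((96 − 67√2)/4)·(k+1) → varInterceptTwo a b`.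
(§4's second-order asymptotics of `Ĉ²_D`, §3's first-order asymptotics of `Ĉ_D`, the geometric convergence of `D̂`, §1's variance algebra, and §5's
identities `qA = μ₁²`, `(q + ℓ)A − 2μ₁μ₀ = φ₃(1 − φ₃ + 2ψ₃)A²`, `φ₃(1 − φ₃ + 2ψ₃) = (96 − 67√2)/4`.)
[cite: Feller1968, XIII.6 (Var N_k = (σ²/μ³)k + O(1) for a scalar renewal process); DuminilCopinHammond2013, §2.2; lane «pcv-sawmu» a-p2 g27 — own result, not in print] -/
theorem tendsto_varTopTwo_sub_linear (a b : Fin (2 * 2)) :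
    Tendsto (fun k : ℕ => varTopTwo (k + 1) a b - (96 - 67 * Real.sqrt 2) / 4 * ((k : ℝ) + 1)) atTop (𝓝 (varInterceptTwo a b)) := by
  have hA : limTwo a b ≠ 0 := (limTwo_pos a b).ne'
  have hq : quadQTwo a b * limTwo a b = slopeCTwo a b ^ 2 := quadQTwo_mul_limTwo a b
  have hD := tendsto_sq_mul_hatD_sub a b
  have hC := tendsto_mul_hatCD_sub a b
  have hQ : Tendsto (fun k : ℕ => hatC2D (stripYT 2) (k + 1) a b
      - (quadQTwo a b * ((k : ℝ) + 1) ^ 2 + (quadQTwo a b + linQTwo a b) * ((k : ℝ) + 1) + constQTwo a b)) atTop (𝓝 0) := by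
    have := (tendsto_hatC2D_two_sub_quadratic a b).sub_const (constQTwo a b)
    rw [sub_self] at this
    refine this.congr fun k => ?_
    ring
  have h := tendsto_ratio_var_sub_linear (D := fun k => hatD 2 (stripYT 2) (k + 1) a b) (C := fun k => hatCD (stripYT 2) (k + 1) a b)
    (Q := fun k => hatC2D (stripYT 2) (k + 1) a b) hA hq hD hC hQ
  have hrate : ((quadQTwo a b + linQTwo a b) * limTwo a b - 2 * slopeCTwo a b * interceptCTwo a b) / limTwo a b ^ 2
      = (96 - 67 * Real.sqrt 2) / 4 := by
    rw [varRate_identity, varRateHat_eq]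
    field_simp
  rw [hrate] at h
  have hV : (constQTwo a b * limTwo a b - interceptCTwo a b ^ 2) / limTwo a b ^ 2 = varInterceptTwo a b := rfl
  rw [hV] at h
  refine h.congr fun k => ?_
  simp only [varTopTwo, meanTopTwo]

/-- ★ **The mean to order one**: `meanTopTwo (k+1) a b − ((3 − √2)/2)·(k+1) → interceptCTwo a b/limTwo a b` — the expected number of surface
contacts is `2θ₂` per hat index (`θ₂ = (3 − √2)/4` per step, «CONTACT-DENSITY») plus an explicit bounded correction.
[cite: Feller1968, XIII.6 (E N_k = k/μ + O(1)); lane «pcv-sawmu» a-p2 g27 — own result] -/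
theorem tendsto_meanTopTwo_sub_linear (a b : Fin (2 * 2)) :
    Tendsto (fun k : ℕ => meanTopTwo (k + 1) a b - (3 - Real.sqrt 2) / 2 * ((k : ℝ) + 1)) atTop (𝓝 (interceptCTwo a b / limTwo a b)) := by
  have hA : limTwo a b ≠ 0 := (limTwo_pos a b).ne'
  have R1 := limTwo_three_mul_phiTwo a b
  have hφ : phiTwo 3 = (3 - Real.sqrt 2) / 2 := phiTwo_three_eq.2
  have hμ : slopeCTwo a b = (3 - Real.sqrt 2) / 2 * limTwo a b := by rw [slopeCTwo_eq, ← hφ, R1]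
  have hD2 := tendsto_sq_mul_hatD_sub a b
  have hC2 := tendsto_mul_hatCD_sub a b
  have hinv : Tendsto (fun k : ℕ => ((k : ℝ) + 1)⁻¹) atTop (𝓝 0) := by
    have := (tendsto_one_div_add_atTop_nhds_zero_nat : Tendsto (fun n : ℕ => 1 / ((n : ℝ) + 1)) atTop (𝓝 0))
    simpa using this
  -- `(k+1)(D − A) → 0`, `C − (μ₁(k+1) + μ₀) → 0`, `D → A`
  have hD1 : Tendsto (fun k : ℕ => ((k : ℝ) + 1) * (hatD 2 (stripYT 2) (k + 1) a b - limTwo a b)) atTop (𝓝 0) := by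
    have := hD2.mul hinv
    rw [mul_zero] at this
    refine this.congr fun k => ?_
    have hk : ((k : ℝ) + 1) ≠ 0 := by positivity
    field_simp
  have hD0 : Tendsto (fun k : ℕ => hatD 2 (stripYT 2) (k + 1) a b) atTop (𝓝 (limTwo a b)) := by
    have := hD1.mul hinv
    rw [mul_zero] at this
    have h' : Tendsto (fun k : ℕ => hatD 2 (stripYT 2) (k + 1) a b - limTwo a b) atTop (𝓝 0) := by
      refine this.congr fun k => ?_
      have hk : ((k : ℝ) + 1) ≠ 0 := by positivity
      field_simp
    have := h'.add_const (limTwo a b)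
    simpa using this
  have hC0 : Tendsto (fun k : ℕ => hatCD (stripYT 2) (k + 1) a b - (slopeCTwo a b * ((k : ℝ) + 1) + interceptCTwo a b)) atTop (𝓝 0) := by
    have := hC2.mul hinv
    rw [mul_zero] at this
    refine this.congr fun k => ?_
    have hk : ((k : ℝ) + 1) ≠ 0 := by positivity
    field_simp
  -- numerator `C − φ₃(k+1)D = μ₀ + (C − μ₁(k+1) − μ₀) − φ₃ (k+1)(D − A)` → μ₀
  have hnum : Tendsto (fun k : ℕ => hatCD (stripYT 2) (k + 1) a b - (3 - Real.sqrt 2) / 2 * ((k : ℝ) + 1) * hatD 2 (stripYT 2) (k + 1) a b)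
      atTop (𝓝 (interceptCTwo a b)) := by
    have t := (hC0.sub (hD1.const_mul ((3 - Real.sqrt 2) / 2))).add_const (interceptCTwo a b)
    rw [mul_zero, sub_zero, zero_add] at t
    refine t.congr fun k => ?_
    rw [hμ]
    ring
  have hquot := hnum.div hD0 hA
  have hDne : ∀ᶠ k : ℕ in atTop, hatD 2 (stripYT 2) (k + 1) a b ≠ 0 := hD0.eventually_ne hA
  refine hquot.congr' ?_
  filter_upwards [hDne] with k hk
  simp only [meanTopTwo, Pi.div_apply]
  field_simp

/-- Corollary: the variance INCREMENTS converge — `varTopTwo (k+2) a b − varTopTwo (k+1) a b → (96 − 67√2)/4` (`= 0.3119228…`; the face computed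
from the three recursions alone). [cite: Feller1968, XIII.6; lane «pcv-sawmu» a-p2 g27] -/
theorem tendsto_varTopTwo_succ_sub (a b : Fin (2 * 2)) :
    Tendsto (fun k : ℕ => varTopTwo (k + 2) a b - varTopTwo (k + 1) a b) atTop (𝓝 ((96 - 67 * Real.sqrt 2) / 4)) := by
  have h := tendsto_varTopTwo_sub_linear a b
  have h1 := h.comp (tendsto_add_atTop_nat 1)
  have t := (h1.sub h).add_const ((96 - 67 * Real.sqrt 2) / 4)
  rw [sub_self, zero_add] at t
  refine t.congr fun k => ?_
  simp only [Function.comp]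
  push_cast
  ring

/-- Corollary: `varTopTwo k a b / k → (96 − 67√2)/4`. [cite: Feller1968, XIII.6; lane «pcv-sawmu» a-p2 g27] -/
theorem tendsto_varTopTwo_div (a b : Fin (2 * 2)) :
    Tendsto (fun k : ℕ => varTopTwo k a b / (k : ℝ)) atTop (𝓝 ((96 - 67 * Real.sqrt 2) / 4)) := by
  have h := tendsto_varTopTwo_sub_linear a b
  have hinv : Tendsto (fun k : ℕ => ((k : ℝ) + 1)⁻¹) atTop (𝓝 0) := by
    have := (tendsto_one_div_add_atTop_nhds_zero_nat : Tendsto (fun n : ℕ => 1 / ((n : ℝ) + 1)) atTop (𝓝 0))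
    simpa using this
  have t := (h.mul hinv).add_const ((96 - 67 * Real.sqrt 2) / 4)
  rw [mul_zero, zero_add] at t
  have t' : Tendsto (fun k : ℕ => varTopTwo (k + 1) a b / (((k + 1 : ℕ) : ℝ))) atTop (𝓝 ((96 - 67 * Real.sqrt 2) / 4)) := by
    refine t.congr fun k => ?_
    have hk : ((k : ℝ) + 1) ≠ 0 := by positivity
    push_cast
    field_simp
    ring
  exact (tendsto_add_atTop_iff_nat 1).1 t'

/-- ★ Corollary, PER STEP: a bridge `a → b` of hat index `k` has `hatLen k a b = 2k + χ_a − χ_b` steps, so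
`varTopTwo k a b / (number of steps) → σ₂² = (96 − 67√2)/8 = 0.155961…` — the variance rate of the surface-contact count of the critical width-two strip.
[cite: Feller1968, XIII.6; DuminilCopinHammond2013, §2.2; lane «pcv-sawmu» a-p2 g27 — own result, not in print] -/
theorem tendsto_varTopTwo_div_hatLen (a b : Fin (2 * 2)) :
    Tendsto (fun k : ℕ => varTopTwo k a b / ((hatLen k a b : ℤ) : ℝ)) atTop (𝓝 ((96 - 67 * Real.sqrt 2) / 8)) := by
  have h := tendsto_varTopTwo_div a b
  set c : ℝ := ((lchi a : ℤ) : ℝ) - ((lchi b : ℤ) : ℝ) with hc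
  -- `k/(2k + c) → 1/2`
  have hinv : Tendsto (fun k : ℕ => ((k : ℝ))⁻¹) atTop (𝓝 0) := tendsto_inv_atTop_zero.comp tendsto_natCast_atTop_atTop
  have hhalf : Tendsto (fun k : ℕ => (k : ℝ) / (2 * (k : ℝ) + c)) atTop (𝓝 (1 / 2)) := by
    have t0 : Tendsto (fun k : ℕ => 2 + c * ((k : ℝ))⁻¹) atTop (𝓝 (2 + c * 0)) := (hinv.const_mul c).const_add 2
    rw [mul_zero, add_zero] at t0
    have t : Tendsto (fun k : ℕ => (2 + c * ((k : ℝ))⁻¹)⁻¹) atTop (𝓝 (2⁻¹)) := t0.inv₀ (by norm_num)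
    rw [show (1 : ℝ) / 2 = 2⁻¹ by norm_num]
    refine t.congr' ?_
    filter_upwards [eventually_gt_atTop 0] with k hk
    have hk' : (k : ℝ) ≠ 0 := by exact_mod_cast hk.ne'
    field_simp
  have t := h.mul hhalf
  have hlim : (96 - 67 * Real.sqrt 2) / 4 * (1 / 2) = (96 - 67 * Real.sqrt 2) / 8 := by ring
  rw [hlim] at t
  refine t.congr' ?_
  filter_upwards [eventually_gt_atTop 0] with k hk
  have hk' : (k : ℝ) ≠ 0 := by exact_mod_cast hk.ne'
  have hlen : ((hatLen k a b : ℤ) : ℝ) = 2 * (k : ℝ) + c := by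
    rw [hc, hatLen]; push_cast; ring
  rw [hlen]
  field_simp

end W2

end HV

end Literature.Probability.RandomPlanarGeometry.SAW
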